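import Mathlib
import HarnessLib
import Literature.NumberTheory.Sieve.BatemanHorn
import Literature.NumberTheory.Sieve.BatemanHornProofs
import Literature.NumberTheory.Sieve.BatemanHornLocalCounts

/-!
# The law of the local pattern on `ℤ/p²` (stub `stub_localFactorLaw`, Stage A of S4)

Line `smooth-rough-lattice-acquisition` of crux stmt-Parity-11291
(`Summit.Parity.BatemanHorn.Theses.AlmostPrimeZeros.SystemZeroRepulsion`), stub S4, Stage A.

For a Bateman–Horn system `f = (f_i)` and a prime `p` let
`π_p(b) = Σ_i ([p ∣ f_i(b)] + [p² ∣ f_i(b)])` (`b ∈ ℕ`) be the local (capped valuation) pattern and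
`ω(p) = ω_f(p)` the number of roots of `∏ f_i` modulo `p`.  CLAIM: for all primes `p > P₀(f)`,
`ω(p) ≤ Σ_i deg f_i`, `π_p(b) ≤ 2` for all `b`, `#{b < p² : π_p(b) = 1} = (p − 1) ω(p)` and
`#{b < p² : π_p(b) = 2} = ω(p)`.

Proof.  Beyond `P₀` (tree: `exists_forall_not_dvd_eval_and_dvd_eval`,
`IsBatemanHornSystem.exists_polyRootCountMod_eq_sum`, `exists_forall_prime_polyRootCountMod_pow_eq`):
no two members have a common root modulo `p`, `ω(p) = Σ_i ρ_i(p)`, and `ρ_i(p²) = ρ_i(p) ≤ deg f_i`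
(Hensel).  Hence at most one `i` contributes to `π_p(b)`, so `π_p ≤ 2`;
`{π_p = 2} = ⊔_i {b < p² : p² ∣ f_i(b)}` has `Σ_i ρ_i(p²) = ω(p)` elements;
`{π_p ≥ 1} = {b < p² : p ∣ ∏ f_i(b)}` has `p ω(p)` elements (fibres of `b ↦ b mod p`); and
`#{π_p = 1} = p ω(p) − ω(p)`.
-/

noncomputable section

namespace Summit.Parity.BatemanHorn.Cruxes.SystemZeroRepulsion.SmoothRoughLatticeAcquisition

open Finset Polynomial Literature.NumberTheory.Sieve

/-- The local pattern as a sum over the members divisible by `p`: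
`π_p(b) = Σ_{i : p ∣ f_i(b)} (1 + [p² ∣ f_i(b)])`. -/
private theorem locPat_eq_sum_filter {k : ℕ} (f : Fin k → ℤ[X]) (p b : ℕ) :
    (∑ i, ((if (p : ℤ) ∣ (f i).eval (b : ℤ) then 1 else 0) +
        (if (p : ℤ) ^ 2 ∣ (f i).eval (b : ℤ) then 1 else 0)) : ℕ) =
      ∑ i ∈ univ.filter (fun i : Fin k => (p : ℤ) ∣ (f i).eval (b : ℤ)),
        (1 + (if (p : ℤ) ^ 2 ∣ (f i).eval (b : ℤ) then 1 else 0)) := by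
  classical
  rw [sum_filter]
  refine sum_congr rfl fun i _ => ?_
  by_cases h1 : (p : ℤ) ∣ (f i).eval (b : ℤ)
  · simp [h1]
  · have h2 : ¬(p : ℤ) ^ 2 ∣ (f i).eval (b : ℤ) :=
      fun h => h1 ((dvd_pow_self (p : ℤ) two_ne_zero).trans h)
    simp [h1, h2]

/-- If no two members have a common root modulo `p`, at most one member is divisible by `p` at `b`. -/
private theorem card_filter_dvd_le_one {k : ℕ} (f : Fin k → ℤ[X]) {p : ℕ}
    (hnc : ∀ i j, i ≠ j → ∀ n : ℤ, ¬((p : ℤ) ∣ (f i).eval n ∧ (p : ℤ) ∣ (f j).eval n)) (b : ℕ) :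
    #(univ.filter (fun i : Fin k => (p : ℤ) ∣ (f i).eval (b : ℤ))) ≤ 1 :=
  card_le_one.2 fun i hi j hj => by
    by_contra hij
    exact hnc i j hij b ⟨(mem_filter.1 hi).2, (mem_filter.1 hj).2⟩

/-- `π_p(b) ≤ 2` when no two members have a common root modulo `p`. -/
private theorem locPat_le_two {k : ℕ} (f : Fin k → ℤ[X]) {p : ℕ}
    (hnc : ∀ i j, i ≠ j → ∀ n : ℤ, ¬((p : ℤ) ∣ (f i).eval n ∧ (p : ℤ) ∣ (f j).eval n)) (b : ℕ) :
    (∑ i, ((if (p : ℤ) ∣ (f i).eval (b : ℤ) then 1 else 0) +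
        (if (p : ℤ) ^ 2 ∣ (f i).eval (b : ℤ) then 1 else 0)) : ℕ) ≤ 2 := by
  classical
  rw [locPat_eq_sum_filter]
  have hI := card_filter_dvd_le_one f hnc b
  calc ∑ i ∈ univ.filter (fun i : Fin k => (p : ℤ) ∣ (f i).eval (b : ℤ)),
        (1 + (if (p : ℤ) ^ 2 ∣ (f i).eval (b : ℤ) then 1 else 0))
      ≤ ∑ _i ∈ univ.filter (fun i : Fin k => (p : ℤ) ∣ (f i).eval (b : ℤ)), 2 :=
        sum_le_sum fun i _ => by split_ifs <;> omega
    _ ≤ 2 := by rw [sum_const, smul_eq_mul]; omega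

/-- `π_p(b) ≥ 1` iff `p ∣ ∏_i f_i(b)`. -/
private theorem one_le_locPat_iff {k : ℕ} (f : Fin k → ℤ[X]) {p : ℕ} (hp : p.Prime) (b : ℕ) :
    1 ≤ (∑ i, ((if (p : ℤ) ∣ (f i).eval (b : ℤ) then 1 else 0) +
        (if (p : ℤ) ^ 2 ∣ (f i).eval (b : ℤ) then 1 else 0)) : ℕ) ↔
      (p : ℤ) ∣ ∏ i, (f i).eval (b : ℤ) := by
  rw [(Nat.prime_iff_prime_int.1 hp).dvd_finsetProd_iff]
  constructor
  · intro h
    by_contra hno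
    push Not at hno
    refine absurd h (not_le.2 ?_)
    rw [Nat.lt_one_iff]
    refine sum_eq_zero fun i _ => ?_
    have h1 : ¬(p : ℤ) ∣ (f i).eval (b : ℤ) := hno i (mem_univ i)
    rw [if_neg h1, if_neg fun h => h1 ((dvd_pow_self (p : ℤ) two_ne_zero).trans h)]
    rfl
  · rintro ⟨i, -, hi⟩
    calc 1 ≤ (if (p : ℤ) ∣ (f i).eval (b : ℤ) then 1 else 0) +
          (if (p : ℤ) ^ 2 ∣ (f i).eval (b : ℤ) then 1 else 0) := by rw [if_pos hi]; omega
      _ ≤ _ := single_le_sum (f := fun i => (if (p : ℤ) ∣ (f i).eval (b : ℤ) then 1 else 0) +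
          (if (p : ℤ) ^ 2 ∣ (f i).eval (b : ℤ) then 1 else 0)) (fun _ _ => Nat.zero_le _)
          (mem_univ i)

/-- `π_p(b) = 2` iff some `p² ∣ f_i(b)`, when no two members have a common root modulo `p`. -/
private theorem locPat_eq_two_iff {k : ℕ} (f : Fin k → ℤ[X]) {p : ℕ}
    (hnc : ∀ i j, i ≠ j → ∀ n : ℤ, ¬((p : ℤ) ∣ (f i).eval n ∧ (p : ℤ) ∣ (f j).eval n)) (b : ℕ) :
    (∑ i, ((if (p : ℤ) ∣ (f i).eval (b : ℤ) then 1 else 0) +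
        (if (p : ℤ) ^ 2 ∣ (f i).eval (b : ℤ) then 1 else 0)) : ℕ) = 2 ↔
      ∃ i, (p : ℤ) ^ 2 ∣ (f i).eval (b : ℤ) := by
  classical
  constructor
  · intro h
    rw [locPat_eq_sum_filter] at h
    have hI := card_filter_dvd_le_one f hnc b
    rcases Nat.le_one_iff_eq_zero_or_eq_one.1 hI with h0 | h1
    · rw [card_eq_zero.1 h0, sum_empty] at h
      exact absurd h (by norm_num)
    · obtain ⟨i, hi⟩ := card_eq_one.1 h1
      rw [hi, sum_singleton] at h
      refine ⟨i, ?_⟩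
      by_contra hnd
      rw [if_neg hnd] at h
      exact absurd h (by norm_num)
  · rintro ⟨i, hi⟩
    refine le_antisymm (locPat_le_two f hnc b) ?_
    calc 2 = (if (p : ℤ) ∣ (f i).eval (b : ℤ) then 1 else 0) +
          (if (p : ℤ) ^ 2 ∣ (f i).eval (b : ℤ) then 1 else 0) := by
          rw [if_pos ((dvd_pow_self (p : ℤ) two_ne_zero).trans hi), if_pos hi]
      _ ≤ _ := single_le_sum (f := fun i => (if (p : ℤ) ∣ (f i).eval (b : ℤ) then 1 else 0) +
          (if (p : ℤ) ^ 2 ∣ (f i).eval (b : ℤ) then 1 else 0)) (fun _ _ => Nat.zero_le _)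
          (mem_univ i)

/-- `#{b < p² : π_p(b) = 2} = Σ_i #{b < p² : p² ∣ f_i(b)}` (disjoint union, no common roots). -/
private theorem card_locPat_eq_two {k : ℕ} (f : Fin k → ℤ[X]) {p : ℕ}
    (hnc : ∀ i j, i ≠ j → ∀ n : ℤ, ¬((p : ℤ) ∣ (f i).eval n ∧ (p : ℤ) ∣ (f j).eval n)) :
    #((range (p ^ 2)).filter fun b : ℕ =>
        (∑ i, ((if (p : ℤ) ∣ (f i).eval (b : ℤ) then 1 else 0) +
          (if (p : ℤ) ^ 2 ∣ (f i).eval (b : ℤ) then 1 else 0)) : ℕ) = 2) =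
      ∑ i, #((range (p ^ 2)).filter fun n : ℕ => (p : ℤ) ^ 2 ∣ (f i).eval (n : ℤ)) := by
  classical
  rw [← card_biUnion]
  · congr 1
    ext b
    simp only [mem_filter, mem_biUnion, mem_univ, true_and, locPat_eq_two_iff f hnc b]
    constructor
    · rintro ⟨hb, i, hi⟩
      exact ⟨i, hb, hi⟩
    · rintro ⟨i, hb, hi⟩
      exact ⟨hb, i, hi⟩
  · intro i _ j _ hij
    exact disjoint_filter.2 fun b _ hi hj => hnc i j hij b
      ⟨(dvd_pow_self (p : ℤ) two_ne_zero).trans hi, (dvd_pow_self (p : ℤ) two_ne_zero).trans hj⟩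

/-- In `{0, …, p² − 1}` each residue class modulo `p ≥ 1` has exactly `p` elements. -/
private theorem card_filter_range_sq_mod_eq {p : ℕ} (hp : 0 < p) {r : ℕ} (hr : r < p) :
    #((range (p ^ 2)).filter fun b : ℕ => b % p = r) = p := by
  classical
  have hset : (range (p ^ 2)).filter (fun b : ℕ => b % p = r) =
      (range p).image fun t => r + p * t := by
    ext b
    simp only [mem_filter, mem_range, mem_image]
    constructor
    · rintro ⟨hb, hbr⟩
      refine ⟨b / p, (Nat.div_lt_iff_lt_mul hp).2 (by rw [← pow_two]; exact hb), ?_⟩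
      rw [← hbr]
      exact Nat.mod_add_div b p
    · rintro ⟨t, ht, rfl⟩
      refine ⟨?_, by rw [Nat.add_mul_mod_self_left, Nat.mod_eq_of_lt hr]⟩
      calc r + p * t < p + p * t := by omega
        _ = p * (t + 1) := by ring
        _ ≤ p * p := Nat.mul_le_mul_left p ht
        _ = p ^ 2 := (pow_two p).symm
  rw [hset, card_image_of_injective _ fun t t' (h : r + p * t = r + p * t') =>
    Nat.eq_of_mul_eq_mul_left hp (by omega), card_range]

/-- `#{b < p² : p ∣ ∏_i f_i(b)} = p ω_f(p)` (divisibility by `p` depends only on `b mod p`). -/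
private theorem card_filter_range_sq_dvd_prod {k : ℕ} (f : Fin k → ℤ[X]) {p : ℕ} (hp : 0 < p) :
    #((range (p ^ 2)).filter fun b : ℕ => (p : ℤ) ∣ ∏ i, (f i).eval (b : ℤ)) =
      p * polyRootCountMod f p := by
  classical
  have key : ∀ b : ℕ, (p : ℤ) ∣ ∏ i, (f i).eval (b : ℤ) ↔
      (p : ℤ) ∣ ∏ i, (f i).eval ((b % p : ℕ) : ℤ) := by
    intro b
    rw [← eval_prod, ← eval_prod]
    have h1 : (p : ℤ) ∣ (b : ℤ) - ((b % p : ℕ) : ℤ) := by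
      rw [← Nat.cast_sub (Nat.mod_le b p)]
      exact Int.natCast_dvd_natCast.2 (Nat.dvd_sub_mod b)
    exact dvd_iff_dvd_of_dvd_sub (h1.trans (sub_dvd_eval_sub _ _ _))
  unfold polyRootCountMod
  set T := (range p).filter fun n : ℕ => (p : ℤ) ∣ ∏ i, (f i).eval (n : ℤ) with hT
  rw [card_eq_sum_card_fiberwise (f := fun b : ℕ => b % p) (t := T)]
  · have hfib : ∀ r ∈ T, #(((range (p ^ 2)).filter fun b : ℕ =>
        (p : ℤ) ∣ ∏ i, (f i).eval (b : ℤ)).filter fun b => b % p = r) = p := by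
      intro r hr
      rw [hT, mem_filter, mem_range] at hr
      rw [filter_filter]
      have : (range (p ^ 2)).filter (fun b : ℕ => ((p : ℤ) ∣ ∏ i, (f i).eval (b : ℤ)) ∧ b % p = r) =
          (range (p ^ 2)).filter fun b : ℕ => b % p = r := by
        refine filter_congr fun b _ => ⟨fun h => h.2, fun h => ⟨?_, h⟩⟩
        rw [key b, h]
        exact hr.2
      rw [this, card_filter_range_sq_mod_eq hp hr.1]
    rw [sum_congr rfl hfib, sum_const, smul_eq_mul, mul_comm]
  · intro b hb
    rw [mem_coe, mem_filter, mem_range] at hb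
    rw [mem_coe, hT, mem_filter, mem_range]
    exact ⟨Nat.mod_lt _ hp, (key b).1 hb.2⟩

/-- **Stage A `stub_localFactorLaw`** (the law of the local pattern `π_p` on `ℤ/p²` at the good
primes).  For a Bateman–Horn system `f` there is `P₀` such that for every prime `p > P₀`:
`ω_f(p) ≤ Σ_i deg f_i`; `π_p(b) ≤ 2` for every `b`; `#{b < p² : π_p(b) = 1} = (p − 1) ω_f(p)`;
`#{b < p² : π_p(b) = 2} = ω_f(p)`. -/
theorem stub_localFactorLaw :
    ∀ (k : ℕ) (f : Fin k → Polynomial ℤ), Literature.NumberTheory.Sieve.IsBatemanHornSystem f →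
      ∃ P₀ : ℕ, ∀ p : ℕ, p.Prime → P₀ < p →
        Literature.NumberTheory.Sieve.polyRootCountMod f p ≤ ∑ i, (f i).natDegree ∧
        (∀ b : ℕ, (∑ i, ((if (p : ℤ) ∣ (f i).eval (b : ℤ) then 1 else 0) +
            (if (p : ℤ) ^ 2 ∣ (f i).eval (b : ℤ) then 1 else 0)) : ℕ) ≤ 2) ∧
        ((Finset.range (p ^ 2)).filter (fun b : ℕ =>
            (∑ i, ((if (p : ℤ) ∣ (f i).eval (b : ℤ) then 1 else 0) +
              (if (p : ℤ) ^ 2 ∣ (f i).eval (b : ℤ) then 1 else 0)) : ℕ) = 1)).card =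
          (p - 1) * Literature.NumberTheory.Sieve.polyRootCountMod f p ∧
        ((Finset.range (p ^ 2)).filter (fun b : ℕ =>
            (∑ i, ((if (p : ℤ) ∣ (f i).eval (b : ℤ) then 1 else 0) +
              (if (p : ℤ) ^ 2 ∣ (f i).eval (b : ℤ) then 1 else 0)) : ℕ) = 2)).card =
          Literature.NumberTheory.Sieve.polyRootCountMod f p := by
  intro k f hf
  classical
  obtain ⟨P₁, hP₁⟩ := hf.exists_polyRootCountMod_eq_sum
  obtain ⟨P₂, hP₂⟩ :=
    exists_forall_not_dvd_eval_and_dvd_eval hf.irreducible hf.pairwise_not_associated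
  choose E hE0 hE using fun i =>
    exists_forall_prime_polyRootCountMod_pow_eq (hf.irreducible i) (hf.natDegree_pos i)
  refine ⟨P₁ + P₂ + ∑ i, E i, fun p hp hP => ?_⟩
  have hω := hP₁ p hp (by omega)
  have hnc := hP₂ p (by omega)
  have hEi : ∀ i, polyRootCountMod ![f i] (p ^ 2) = polyRootCountMod ![f i] p ∧
      polyRootCountMod ![f i] p ≤ (f i).natDegree := by
    intro i
    refine hE i p hp ?_ 2 (by norm_num)
    intro hd
    have h1 : E i ≤ ∑ i, E i := single_le_sum (f := E) (fun _ _ => Nat.zero_le _) (mem_univ i)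
    have h2 := Nat.le_of_dvd (Nat.pos_of_ne_zero (hE0 i)) hd
    omega
  -- the count of `π_p = 2`
  have h2 : #((range (p ^ 2)).filter fun b : ℕ =>
      (∑ i, ((if (p : ℤ) ∣ (f i).eval (b : ℤ) then 1 else 0) +
        (if (p : ℤ) ^ 2 ∣ (f i).eval (b : ℤ) then 1 else 0)) : ℕ) = 2) = polyRootCountMod f p := by
    rw [card_locPat_eq_two f hnc, hω]
    refine sum_congr rfl fun i _ => ?_
    rw [← (hEi i).1, polyRootCountMod_single, Nat.cast_pow]
  -- the count of `π_p ≥ 1`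
  have h1 : #((range (p ^ 2)).filter fun b : ℕ =>
      1 ≤ (∑ i, ((if (p : ℤ) ∣ (f i).eval (b : ℤ) then 1 else 0) +
        (if (p : ℤ) ^ 2 ∣ (f i).eval (b : ℤ) then 1 else 0)) : ℕ)) = p * polyRootCountMod f p := by
    rw [← card_filter_range_sq_dvd_prod f hp.pos]
    congr 1
    exact filter_congr fun b _ => one_le_locPat_iff f hp b
  refine ⟨?_, locPat_le_two f hnc, ?_, h2⟩
  · rw [hω]
    exact sum_le_sum fun i _ => (hEi i).2
  · -- `#{π = 1} = #{π ≥ 1} − #{π = 2}`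
    have hsplit := card_filter_add_card_filter_not (s := (range (p ^ 2)).filter fun b : ℕ =>
      1 ≤ (∑ i, ((if (p : ℤ) ∣ (f i).eval (b : ℤ) then 1 else 0) +
        (if (p : ℤ) ^ 2 ∣ (f i).eval (b : ℤ) then 1 else 0)) : ℕ))
      (fun b : ℕ => (∑ i, ((if (p : ℤ) ∣ (f i).eval (b : ℤ) then 1 else 0) +
        (if (p : ℤ) ^ 2 ∣ (f i).eval (b : ℤ) then 1 else 0)) : ℕ) = 2)
    rw [filter_filter, filter_filter, h1] at hsplit
    have e2 : (range (p ^ 2)).filter (fun b : ℕ =>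
        1 ≤ (∑ i, ((if (p : ℤ) ∣ (f i).eval (b : ℤ) then 1 else 0) +
          (if (p : ℤ) ^ 2 ∣ (f i).eval (b : ℤ) then 1 else 0)) : ℕ) ∧
        (∑ i, ((if (p : ℤ) ∣ (f i).eval (b : ℤ) then 1 else 0) +
          (if (p : ℤ) ^ 2 ∣ (f i).eval (b : ℤ) then 1 else 0)) : ℕ) = 2) =
        (range (p ^ 2)).filter fun b : ℕ =>
          (∑ i, ((if (p : ℤ) ∣ (f i).eval (b : ℤ) then 1 else 0) +
            (if (p : ℤ) ^ 2 ∣ (f i).eval (b : ℤ) then 1 else 0)) : ℕ) = 2 :=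
      filter_congr fun b _ => ⟨fun h => h.2, fun h => ⟨by omega, h⟩⟩
    have e1 : (range (p ^ 2)).filter (fun b : ℕ =>
        1 ≤ (∑ i, ((if (p : ℤ) ∣ (f i).eval (b : ℤ) then 1 else 0) +
          (if (p : ℤ) ^ 2 ∣ (f i).eval (b : ℤ) then 1 else 0)) : ℕ) ∧
        ¬(∑ i, ((if (p : ℤ) ∣ (f i).eval (b : ℤ) then 1 else 0) +
          (if (p : ℤ) ^ 2 ∣ (f i).eval (b : ℤ) then 1 else 0)) : ℕ) = 2) =
        (range (p ^ 2)).filter fun b : ℕ =>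
          (∑ i, ((if (p : ℤ) ∣ (f i).eval (b : ℤ) then 1 else 0) +
            (if (p : ℤ) ^ 2 ∣ (f i).eval (b : ℤ) then 1 else 0)) : ℕ) = 1 := by
      refine filter_congr fun b _ => ?_
      have := locPat_le_two f hnc b
      omega
    rw [e2, e1, h2] at hsplit
    have : (p - 1) * polyRootCountMod f p + polyRootCountMod f p = p * polyRootCountMod f p := by
      rw [Nat.sub_one_mul, Nat.sub_add_cancel (Nat.le_mul_of_pos_left _ hp.pos)]
    omega

end Summit.Parity.BatemanHorn.Cruxes.SystemZeroRepulsion.SmoothRoughLatticeAcquisition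

end
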